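import Literature.Computability.Complexity.TFNPProblems
import HarnessLib

/-!
# The canonical total search problems III: SINK-OF-DAG and ITER (polynomial local search)

Continuation of `TFNPProblems.lean` (conventions there: circuits as lists of programs of
`CircEval.evalFn` — `TFNP.evalBits`; vertices `{0,1}ⁿ` with `0ⁿ = TFNP.zero n`; values read by
`bitsToNat`; codes `TFNP.instCode n Cs`; problems `TFNP.ofCircuits V Sol`) and of
`TFNPClasses.lean` (LOCALOPT = `TFNP.LocalOpt`, `PLS = TFNP.closureOf TFNP.LocalOpt`). Two
further standard presentations of polynomial local search `PLS` (Johnson–Papadimitriou–Yannakakis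
1988) by circuit problems, next to LOCALOPT (FGHS22 Def. 2, `TFNPClasses.lean`):

| problem | data `Cs` | valid | solutions `x` (`|x| = n`) | source |
|---|---|---|---|---|
| `SinkOfDag` | `[S, V]` | `S 0 ≠ 0` | `S x ≠ x` and (`S (S x) = S x` or `V (S x) ≤ V x`) | FGMS20 Def. 8 |
| `Iter` | `[C]` | `C 0 > 0` | `C x < x`, or `C x > x ∧ C (C x) = C x` (as numbers) | FGHS22 Def. 3 (Morioka) |

FGMS20 present `PLS` by SINK-OF-DAG ("while this is not the standard definition of PLS, … the
standard PLS-complete problem can easily be recast as a SINK-OF-DAG instance"), and ITER is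
`PLS`-complete (Morioka 2001, via FGHS22) — inter-reducibility statements NOT vendored here.

Proved API: unfolding, polynomial balance, and TOTALITY of both (the "potential function"
existence arguments: a vertex of largest potential is a sink; a right-moving vertex of largest
value — realised with `Nat.find`). Not here: `rel ∈ P` / `valid ∈ P`.

## References

* J. Fearnley, S. Gordon, R. Mehta, R. Savani, *Unique end of potential line*, JCSS 114 (2020);
  arXiv:1811.03841 §2, Def. 8 (SINK-OF-DAG; its "S(S(x)) = x" is a typo for "S(S(x)) = S(x)",
  cf. Def. 15, UF1).
* J. Fearnley, P. W. Goldberg, A. Hollender, R. Savani, *The complexity of gradient descent*,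
  J. ACM 70 (2022); arXiv:2011.01929 §3.1.2, Def. 3 (ITER; Def. 2 is LOCALOPT).
* D. S. Johnson, C. H. Papadimitriou, M. Yannakakis, *How easy is local search?*, JCSS 37 (1988)
  (the class PLS).
-/

namespace Literature.Computability.Complexity

open _root_.Computability

namespace TFNP

/-! ### SINK-OF-DAG, ITER -/

/-- Side condition of SINK-OF-DAG on `(n, [S, V])`: `S(0ⁿ) ≠ 0ⁿ`. [FGMS 2020, Def. 8]
[cite: FearnleyGordonMehtaSavani2020, Def. 8] -/
def SinkOfDag.IsValid (n : ℕ) : List (List (List Bool)) → Prop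
  | [S, _V] => S.length = n ∧ evalBits S (zero n) ≠ zero n
  | _ => False

/-- Solutions of SINK-OF-DAG: `S(x) ≠ x` and either `S(S(x)) = S(x)` (the successor is not a
vertex) or `V(S(x)) ≤ V(x)` (the potential does not increase). (The arXiv text of Def. 8 prints
"`S(S(x)) = x`", a typo for `S(S(x)) = S(x)` as in the same paper's Def. 15 (UF1) and its use in
App. B.) [FGMS 2020, Def. 8 (S1) and Def. 15 (UF1)] [cite: FearnleyGordonMehtaSavani2020, Def. 8] -/
def SinkOfDag.IsSolution (n : ℕ) : List (List (List Bool)) → List Bool → Prop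
  | [S, V], x => x.length = n ∧ evalBits S x ≠ x ∧
      (evalBits S (evalBits S x) = evalBits S x ∨
        bitsToNat (evalBits V (evalBits S x)) ≤ bitsToNat (evalBits V x))
  | _, _ => False

/-- **SINK-OF-DAG.** Given `S : {0,1}ⁿ → {0,1}ⁿ` with `S(0ⁿ) ≠ 0ⁿ` and `V : {0,1}ⁿ → {0, …, 2ᵐ − 1}`,
find `x` with `S(x) ≠ x` and (`S(S(x)) = S(x)` or `V(S(x)) ≤ V(x)`) — a `PLS`-complete problem
(FGMS use it to present `PLS`). [FGMS 2020, Def. 8] [cite: FearnleyGordonMehtaSavani2020, Def. 8] -/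
def SinkOfDag : SearchProblem :=
  ofCircuits SinkOfDag.IsValid SinkOfDag.IsSolution

/-- SINK-OF-DAG is polynomially balanced. [folklore] -/
theorem SinkOfDag.isPolyBalanced : SinkOfDag.IsPolyBalanced := by
  refine ofCircuits_isPolyBalanced 1 fun n Cs x h => ?_
  match Cs, h with
  | [S, V], h => simp only [SinkOfDag.IsSolution] at h; omega

/-- **SINK-OF-DAG is total**: a vertex of largest potential is a sink ("the DAG has at least one
vertex, and therefore it must also have at least one sink"). Realised with `Nat.find` on the
deficiency `2^m − V(x)` over the vertices `x` (`S(x) ≠ x`), `0ⁿ` being one. [FGMS 2020, §2 (after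
Def. 8)] [cite: FearnleyGordonMehtaSavani2020, Def. 8] -/
theorem SinkOfDag.isTotal : SinkOfDag.IsTotal := by
  classical
  refine ofCircuits_isTotal_iff.2 fun n Cs hV => ?_
  match Cs, hV with
  | [S, V], hV =>
    simp only [SinkOfDag.IsValid] at hV
    simp only [SinkOfDag.IsSolution]
    by_contra hno
    simp only [not_exists, not_and, not_or, not_le] at hno
    -- vertices `x` (`S x ≠ x`) by decreasing potential: minimise the deficiency `B - V x`
    set B := 2 ^ V.length with hB
    have hlt : ∀ x, bitsToNat (evalBits V x) < B := fun x => by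
      rw [hB, ← length_evalBits V x]; exact bitsToNat_lt _
    have hex : ∃ (d : ℕ) (x : List Bool), x.length = n ∧ evalBits S x ≠ x ∧ B - bitsToNat (evalBits V x) = d :=
      ⟨_, zero n, length_zero n, hV.2, rfl⟩
    obtain ⟨x, hxn, hxS, hxd⟩ := Nat.find_spec hex
    obtain ⟨hSS, hVlt⟩ := hno x hxn hxS
    have hyn : (evalBits S x).length = n := by rw [length_evalBits, hV.1]
    have hmin := Nat.find_min' hex ⟨evalBits S x, hyn, hSS, rfl⟩
    have h1 := hlt x
    have h2 := hlt (evalBits S x)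
    omega

/-- Side condition of ITER on `(n, [C])`: `C(0) > 0` (strings read as numbers by `bitsToNat`,
the least vertex being `0ⁿ`). [FGHS 2022, Def. 3 ("C(1) > 1" on `[2ⁿ]`)]
[cite: FearnleyGoldbergHollenderSavani2022, Def. 3] -/
def Iter.IsValid (n : ℕ) : List (List (List Bool)) → Prop
  | [C] => C.length = n ∧ 0 < bitsToNat (evalBits C (zero n))
  | _ => False

/-- Solutions of ITER: `C(x) < x`, or `C(x) > x` and `C(C(x)) = C(x)`. [FGHS 2022, Def. 3]
[cite: FearnleyGoldbergHollenderSavani2022, Def. 3] -/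
def Iter.IsSolution (n : ℕ) : List (List (List Bool)) → List Bool → Prop
  | [C], x => x.length = n ∧ (bitsToNat (evalBits C x) < bitsToNat x ∨
      (bitsToNat x < bitsToNat (evalBits C x) ∧ evalBits C (evalBits C x) = evalBits C x))
  | _, _ => False

/-- **ITER.** Given `C : [2ⁿ] → [2ⁿ]` with `C(0) > 0`, find `x` with `C(x) < x`, or `C(x) > x` and
`C(C(x)) = C(x)` — `PLS`-complete (Morioka 2001). [FGHS 2022, Def. 3]
[cite: FearnleyGoldbergHollenderSavani2022, Def. 3] -/
def Iter : SearchProblem :=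
  ofCircuits Iter.IsValid Iter.IsSolution

/-- ITER is polynomially balanced. [folklore] -/
theorem Iter.isPolyBalanced : Iter.IsPolyBalanced := by
  refine ofCircuits_isPolyBalanced 1 fun n Cs x h => ?_
  match Cs, h with
  | [C], h => simp only [Iter.IsSolution] at h; omega

/-- **ITER is total** ("apply `C` repeatedly on node 1"): a vertex `x` with `x < C(x)` of largest
value is a solution or yields the larger such vertex `C(x)`. [FGHS 2022, §3.1.2 (after Def. 3)]
[cite: FearnleyGoldbergHollenderSavani2022, Def. 3] -/
theorem Iter.isTotal : Iter.IsTotal := by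
  classical
  refine ofCircuits_isTotal_iff.2 fun n Cs hV => ?_
  match Cs, hV with
  | [C], hV =>
    simp only [Iter.IsValid] at hV
    simp only [Iter.IsSolution]
    by_contra hno
    simp only [not_exists, not_and, not_or, not_lt] at hno
    set B := 2 ^ n with hB
    have hlt : ∀ x : List Bool, x.length = n → bitsToNat x < B := fun x hx => by
      rw [hB, ← hx]; exact bitsToNat_lt _
    have hex : ∃ (d : ℕ) (x : List Bool), x.length = n ∧ bitsToNat x < bitsToNat (evalBits C x) ∧ B - bitsToNat x = d :=
      ⟨_, zero n, length_zero n, by rw [bitsToNat_zero]; exact hV.2, rfl⟩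
    obtain ⟨x, hxn, hxC, hxd⟩ := Nat.find_spec hex
    obtain ⟨-, hCC⟩ := hno x hxn
    have hyn : (evalBits C x).length = n := by rw [length_evalBits, hV.1]
    -- `y = C x` is mapped to the right as well (no solution at `y`), strictly (`C (C x) ≠ C x`)
    obtain ⟨hyC, -⟩ := hno (evalBits C x) hyn
    have hne : evalBits C (evalBits C x) ≠ evalBits C x := fun h => (hCC hxC) h
    have hylt : bitsToNat (evalBits C x) < bitsToNat (evalBits C (evalBits C x)) := by
      refine lt_of_le_of_ne hyC fun h => hne ?_
      -- equal values and equal lengths give equal strings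
      exact (bitsToNat_injOn_length (by rw [length_evalBits, length_evalBits]) h.symm)
    have hmin := Nat.find_min' hex ⟨evalBits C x, hyn, hylt, rfl⟩
    have h1 := hlt x hxn
    have h2 := hlt _ hyn
    omega

end TFNP

end Literature.Computability.Complexity
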